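import Literature.MathematicalPhysics.QuantumFieldTheory.Balaban1983to89.Node00.N24KnitStage13All
import Literature.MathematicalPhysics.QuantumFieldTheory.Balaban1983to89.Node00.Record13Carriers

/-!
# NODE N24 · (B2) AND ITEM K1‴'s RUNG BODIES AT A WORLD BOUND TO NODE 00's FOUR-PIN STAGE-13 VIEW `θ.view₁₃B10YZW` — modules 29 ∕ 33's recipe at Stage 13, over
# seat dag-n10-d's carrier stack `Node00/Record13Carriers` (p490901): N08 ← THE PRINTED `PrintedUV3V N θ.L`, N06 ∕ N07 ∕ N12 ← their leaves AT THE CHOSEN LAYERS,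
# N11 ∧ N13 θ-keyed (dag-n11-a's construction-generic (S1ᵀ) engine, dag-n13-a's construction-generic (R)+(UV) engine), N09 a displayed leaf + Theorem-3 binder

TRACK A (YM-PLAN §2d, node N24 of 28 = binder B2 `hB : B16.EndStatementBPrinted D.C`), seat `pub-ymgap-dag-n24-c` (R134 fan-out seat, strategy s2 «`N24_at_record…_knit_all_carriers_pinned`
(module 17 recipe)»; gen 3; HANDOFF trigger (t3″): the ₁₃ carrier stack is in the tree).  FORTIETH N24 module, a NEW importing one (modules 1–39 untouched; imports module 38
`N24KnitStage13All` and node 00's `Record13Carriers`).  THEOREMS ONLY, def-free, sorry-free, standard axioms.  Route of record rev 16: item K1‴ `StabilityBAtRecordR13e`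
(stmt-QuantumFields-19910), whose registered skeleton (plan g66 `K1Skeleton13.lean`) has the two stubs `stub_nodes13 : Inhabited13 F → NodesAtSomeRecord13 F` and
`stub_betaWindow13 : NodesAtSomeRecord13 F → BetaWindowAtSomeRecord13 F`; §3 below gives the BODIES of both rungs at general `N` from the pointed children (N24 is COMPOSITE: the
hypothesis list is «which child blocks», nothing is discharged).

THE FOUR-PIN VIEW (dag-n10-d, `Record13Carriers` §4): `θ.view₁₃B10YZW F N M⋆ ops ζ λW = ((((θ.toStage5₁₃).pinB10).pinY (Y9OfRecord N θ.toStage3Params M⋆ ops)).pinZ (Z11OfRecord F N ζ)).pinW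
(WOfRecord₁₃ F N θ λW)` — [B10] runs pinned at print's `runsB10OfRecord N θ.L`, the [B9] group at def-Y's `Y9OfRecord` over a residual operator layer `ops`, the [B11] group at
`Z11OfRecord ζ`, the [IV] group at `WOfRecord₁₃ θ λW` TYPED ALONG THE ₁₃ PLUGS; its leaves by name `upOfRecord₅C_view₁₃B10YZW_leaves`; it IS the Stage-13 view of the quadruply pinned
parameters (`view₁₃B10YZW_eq`), all pins UP-SIDE (`datumOfRecord₁₃_pin*`, `rfl`), so a world bound to it over `(datumOfRecord₁₃ θ hP).C` IS a ₁₃C record at the SAME datum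
(§0 `N24_isRecordOfRecord₁₃C_of_up_view₁₃B10YZW`, the four-pin instance of dag-n10-d's `isRecordOfRecord₁₃C_rebindX_of_eq`), and the pins never touch the 𝐑-carrier
(§0 `N24_rOperation_iff_of_up_view₁₃B10YZW`: the world's 𝐑-leaf is STILL θ's repaired R-law, `Iff.rfl` to `ROpLeaf (VOfRecord₁₃ θ P)` then def-T's `rOpLeaf_VOfRecord₁₃_iff`).

WHAT THIS FILE PROVES.
§0 `N24_isRecordOfRecord₁₃C_of_up_view₁₃B10YZW`, `N24_rOperation_iff_of_up_view₁₃B10YZW`, `N24_exists_boundWorld₁₃B10YZW` (a world bound to the view with any prescribed letters).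
§1 **`N24_nodes₁₃B10YZW_pointed`** — the thirteen nodes at a world bound to the four-pin view: N05 `B8LeafR` at `θ.res.X P`'s [B8] fields (= the view's, `rfl`); N06 `B9LeafX (Y9OfRecord …)`;
   N07 `B11Leaf (Z11OfRecord F N ζ)`; **N08 `PrintedUV3V N θ.L`** (the printed sentence, [Balaban1985UV3] Thm 1 compact + Thm 2 at every run length); N09 own leaf `h09` + Theorem-3 member
   `h09T` DISPLAYED; N10 B13 socket at the view; N11 (S1ᵀ) `h11` (dag-n11-a's `b14_main_at_construction_rhoOfRecord9_along`, start `sLaw₁₃_zero`, 𝐑 read through §0); N12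
   `B15Leaf (WOfRecord₁₃ θ λW P)`; N13 (R₁₃) `hR` + (UV₁₃) `hUV` (dag-n13-a's `b16_main_at_repTowerOfRecord_along` at `coreOfRecord₁₃ θ` with §0's pin reading); N01 ∕ N02 ∕ N04 def-T's
   transferred theorems, N03 module 37's.
§2 **`N24_endStatementBPrinted₁₃_fourPin_pointed`** ((B) at the presentation's datum from §1 + the β-box pair) and **`N24_stabilityBR13e_thetaShape16_fourPin_pointed`** (item K1‴'s
   θ-keyed consequent witnessed by `(θ, hP)`, guard `hU` displayed).
§3 THE RUNG BODIES of K1‴'s registered skeleton at general `N` over the four-pin view: **`N24_nodesAtSomeRecord₁₃_of_fourPin_pointed`** (body of `NodesAtSomeRecord13`) and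
   **`N24_betaWindowAtSomeRecord₁₃_of_fourPin_pointed_of_boxH`** (body of `BetaWindowAtSomeRecord13`, β-bounds by module 38's `N24_betaBoundsInInterval_of_isRecordOfRecord₁₃C_of_boxH`,
   window by module 26's `N24_window_of_betaUpperH`) — witnesses `(θ, hP, w)` themselves.

WHICH CHILD BLOCKS OVER THE FOUR-PIN ₁₃ VIEW AFTER THIS FILE (kernel form) = §1's hypothesis list: N05 [B8] residual leaf at `θ.res.X` · N06 def-Y's leaf at the chosen layer `(M⋆, ops)` ·
N07 [B11] leaf at `ζ` · N08 the PRINTED `PrintedUV3V N θ.L` · N09 Lemma-4 leaf + its Theorem-3 member (the dag-n09 lane's ₁₃ plug) · N10 B13 socket · N11 (S1ᵀ) · N12 [IV] leaf at `λW` ·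
N13 (R₁₃) law transport + (UV₁₃) (0.1) pointwise on `densOfRecord₁₃ θ` · guard + `Provisos₁₃ ∧ Admissible` = K0‴ `Record13Inhabited` (stmt-QuantumFields-19909) · β-box pair ([I] (1.22)
p. 264; lower half UNPRINTED, node O).  NO WORLD-LEVEL NODE HYPOTHESIS, NO PURE NODE BINDER.
HONEST FRAMING: kernel bookkeeping BY NAME; nothing of Bałaban's asserted; every slot DISPLAYED; N24 COMPOSITE — no discharge, no count moved (5∕27), no stub closed; one finite T⁴
programme at fixed ε; NOT continuum ∕ ℝ⁴ ∕ OS ∕ mass gap ∕ Clay.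
-/

noncomputable section

open scoped Matrix.Norms.L2Operator

namespace Literature.MathematicalPhysics.QuantumFieldTheory.Balaban1983to89.Node00

open DagBinding T4Continuum T4DatumAssembly FlowStepRuns AveragingRT
open FlowStep (BetaLowerH BetaUpperH)
open B14NodeKnitRecord9 (b14_main_at_construction_rhoOfRecord9_along)
open B16NodeKnitRepTowerOfRecord (b16_main_at_repTowerOfRecord_along)

variable {F : T4Family} {N : ℕ} [NeZero N]

/-! ## §0. A world bound to the four-pin Stage-13 view: the ₁₃C record at the same datum, its 𝐑-leaf, a bound world with prescribed letters -/

/-- **A WORLD BOUND TO THE FOUR-PIN STAGE-13 VIEW OVER `(datumOfRecord₁₃ θ hP).C` IS A ₁₃C RECORD AT THE SAME DATUM** (presenting parameter the quadruply pinned `θ`; dag-n10-d's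
`view₁₃B10YZW_eq`, `Provisos₁₃.pin*`, `pin*_admissible_iff` (`Iff.rfl`), `datumOfRecord₁₃_pin*` (`rfl`) — the four-pin instance of `isRecordOfRecord₁₃C_rebindX_of_eq`).
[cite: Balaban1989LargeFieldII, Thm 1 + (0.1) pp.355–356; Balaban1985UV3, Thm 1 p.257; Balaban1985BackgroundPropagators, Thm 3.1 p.397; Balaban1985Variational, Thm 1 p.279; Balaban1989LargeFieldI, (0.2) p.176 (bookkeeping)] -/
theorem N24_isRecordOfRecord₁₃C_of_up_view₁₃B10YZW (θ : Stage13Params F N) (hP : θ.Provisos₁₃ F N) (hθ : θ.Admissible F N)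
    (Mstar : ℕ) (ops : OpsY N θ.toStage3Params Mstar) (ζ : ResidZ F N) (lamW : ResidW F N) (w : WorldP)
    (hC : w.C = (datumOfRecord₁₃ F N θ hP).C) (hγ : 0 < w.γ ∧ w.γ ≤ θ.γ) (hL : w.L = (θ.L : ℝ))
    (hup : ∀ P, w.up P = upOfRecord₅C F N (θ.view₁₃B10YZW F N Mstar ops ζ lamW) P) :
    IsRecordOfRecord₁₃C F N (datumOfRecord₁₃ F N θ hP) w := by
  refine ⟨(((θ.pinB10 F N).pinY F N (Y9OfRecord N θ.toStage3Params Mstar ops)).pinZ F N (Z11OfRecord F N ζ)).pinW F N (WOfRecord₁₃ F N θ lamW),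
    ((hP.pinB10.pinY (Y9OfRecord N θ.toStage3Params Mstar ops)).pinZ (Z11OfRecord F N ζ)).pinW (WOfRecord₁₃ F N θ lamW),
    (Stage13Params.pinW_admissible_iff F N _ _).2 ((Stage13Params.pinZ_admissible_iff F N _ _).2
      ((Stage13Params.pinY_admissible_iff F N _ _).2 ((Stage13Params.pinB10_admissible_iff F N θ).2 hθ))), ?_, hC, hγ, hL, fun P => ?_⟩
  · exact ((datumOfRecord₁₃_pinB10 F N θ hP).symm.trans
      ((datumOfRecord₁₃_pinY F N (θ.pinB10 F N) hP.pinB10 (Y9OfRecord N θ.toStage3Params Mstar ops)).symm.trans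
        ((datumOfRecord₁₃_pinZ F N _ (hP.pinB10.pinY (Y9OfRecord N θ.toStage3Params Mstar ops)) (Z11OfRecord F N ζ)).symm.trans
          (datumOfRecord₁₃_pinW F N _ ((hP.pinB10.pinY (Y9OfRecord N θ.toStage3Params Mstar ops)).pinZ (Z11OfRecord F N ζ))
            (WOfRecord₁₃ F N θ lamW)).symm)))
  · rw [hup P, Stage13Params.view₁₃B10YZW_eq]

/-- **THE 𝐑-LEAF OF A WORLD BOUND TO THE FOUR-PIN STAGE-13 VIEW IS θ's REPAIRED R-LAW** `∀ k < K, TLaw₁₃ θ P k → SLaw₁₃ θ P (k+1)`: the pins never touch the 𝐑-carrier (`Iff.rfl` to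
`ROpLeaf (VOfRecord₁₃ F N θ P)`, then def-T's `rOpLeaf_VOfRecord₁₃_iff`). [cite: Balaban1988Convergent, p.244 and Thm 2 p.263; Balaban1989LargeFieldII, Thm 1 p.355 (bookkeeping)] -/
theorem N24_rOperation_iff_of_up_view₁₃B10YZW (θ : Stage13Params F N) (Mstar : ℕ) (ops : OpsY N θ.toStage3Params Mstar) (ζ : ResidZ F N) (lamW : ResidW F N)
    {w : WorldP} {P : B12.RunParams} (hup : w.up P = upOfRecord₅C F N (θ.view₁₃B10YZW F N Mstar ops ζ lamW) P) :
    (leavesP w P).rOperation ↔ ∀ k, k < P.K → TLaw₁₃ F N θ P k → SLaw₁₃ F N θ P (k + 1) := by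
  have hV : (leavesP w P).rOperation ↔ ROpLeaf (VOfRecord₁₃ F N θ P) := by
    show (w.up P).rOperation ↔ _
    rw [hup]
    exact Iff.rfl
  exact hV.trans (rOpLeaf_VOfRecord₁₃_iff F N θ P)

/-- **A WORLD BOUND TO THE FOUR-PIN STAGE-13 VIEW WITH ANY PRESCRIBED LETTERS** (module 38's `N24_exists_boundWorld₁₃` at the view): construction `(datumOfRecord₁₃ θ hP).C`, block size
`θ.L`, letters `(γ, e₋, e₊, β⁺, β₀, b, g_R)` as given (`b, β₀ > 0`). [cite: Balaban1989LargeFieldII, Thm 1 + (0.1) pp.355–356; Balaban1988Convergent, Cor. 3 (2.50) p.264; Balaban1987RG1, Thm 2 p.259 (the letters' printed homes; bookkeeping)] -/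
theorem N24_exists_boundWorld₁₃B10YZW (θ : Stage13Params F N) (hP : θ.Provisos₁₃ F N) (Mstar : ℕ) (ops : OpsY N θ.toStage3Params Mstar) (ζ : ResidZ F N)
    (lamW : ResidW F N) (γw : ℝ) (em ep : ℝ → ℝ) (βup : ℝ) {β₀ b : ℝ} (hβ₀ : 0 < β₀) (hb : 0 < b) (gR : ℝ) :
    ∃ w : WorldP, w.C = (datumOfRecord₁₃ F N θ hP).C ∧ w.γ = γw ∧ w.L = (θ.L : ℝ) ∧
      (∀ P, w.up P = upOfRecord₅C F N (θ.view₁₃B10YZW F N Mstar ops ζ lamW) P) ∧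
      w.em = em ∧ w.ep = ep ∧ w.βup = βup ∧ w.β₀ = β₀ ∧ w.b = b ∧ w.gR = gR :=
  ⟨⟨(datumOfRecord₁₃ F N θ hP).C, γw, em, ep, βup, β₀, hβ₀, b, hb, (θ.L : ℝ), by exact_mod_cast θ.hL.2, gR,
      fun P => upOfRecord₅C F N (θ.view₁₃B10YZW F N Mstar ops ζ lamW) P⟩,
    rfl, rfl, rfl, fun _ => rfl, rfl, rfl, rfl, rfl, rfl, rfl⟩

/-! ## §1. The thirteen nodes at a world bound to the four-pin Stage-13 view, from the pointed children (N08 print-facing; N06 ∕ N07 ∕ N12 at the chosen layers) -/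

/-- **N24 · THE THIRTEEN DAG NODES AT A WORLD BOUND TO THE FOUR-PIN STAGE-13 VIEW, FROM THE CHILDREN AT THE PRESENTATION'S OWN OBJECTS AND THE CHOSEN LAYERS** (module 33's
`N24_nodes₁₂B10YZW_pointed_all` at ₁₃ with N09's Theorem-3 member a displayed binder `h09T`).  A world `w` bound to `θ.view₁₃B10YZW F N M⋆ ops ζ λW` (`hC`, `hγ`, `hL`, `hup`) IS a ₁₃C record
over `datumOfRecord₁₃ θ hP` (§0), and: **N05** `B8LeafR` at `θ.res.X P`'s [B8] fields; **N06** `B9LeafX (Y9OfRecord N θ.toStage3Params M⋆ ops)`; **N07** `B11Leaf (Z11OfRecord F N ζ)`; **N08**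
THE PRINTED SENTENCE `PrintedUV3V N θ.L`; **N09** own leaf `h09` + Theorem-3 member `h09T`; **N10** B13 socket at the view; **N11** (S1ᵀ) `h11`; **N12** `B15Leaf (WOfRecord₁₃ F N θ λW P)`;
**N13** (R₁₃) `hR` + (UV₁₃) `hUV`.  THE HYPOTHESIS LIST IS «WHICH CHILD BLOCKS `stub_nodes13` OVER THE FOUR-PIN VIEW».
[cite: Balaban1989LargeFieldII, Thm 1 p.355, (0.1) pp.355–356, p.387, p.391; Balaban1985UV3, (1)–(5) p.256, Thm 1 p.257 + Thm 2 p.272; Balaban1985BackgroundPropagators, Thm 3.1 p.397; Balaban1985Variational, Thm 1 p.279 + Thm 3 p.278; Balaban1988Convergent, Thm 1 p.262, Theorem p.245, p.244, (2.18) p.257, Cor. 3 (2.50) p.264; Balaban1987RG1, Thm 1 p.259, Thm 3 p.264; Balaban1988RG2Cluster, Lemmas 1–3 pp.7–17; Balaban1989LargeFieldI, Prop. 1 p.194, (0.2)–(0.4) p.176; Balaban1985RegularSpaces, Thm 2 p.83 (bookkeeping)] -/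
theorem N24_nodes₁₃B10YZW_pointed (θ : Stage13Params F N) (hP : θ.Provisos₁₃ F N) (hθ : θ.Admissible F N)
    (Mstar : ℕ) (ops : OpsY N θ.toStage3Params Mstar) (ζ : ResidZ F N) (lamW : ResidW F N) (w : WorldP)
    (hC : w.C = (datumOfRecord₁₃ F N θ hP).C) (hγ : 0 < w.γ ∧ w.γ ≤ θ.γ) (hL : w.L = (θ.L : ℝ))
    (hup : ∀ P, w.up P = upOfRecord₅C F N (θ.view₁₃B10YZW F N Mstar ops ζ lamW) P)
    (h05 : ∀ P : B12.RunParams,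
      B8LeafR (θ.res.X P).d8 (θ.res.X P).L8 (θ.res.X P).C₂ (θ.res.X P).B₁' (θ.res.X P).B₀' (θ.res.X P).B₁ (θ.res.X P).B₂ (θ.res.X P).c₁
        (θ.res.X P).inp8 (θ.res.X P).B₀β (θ.res.X P).loc8 (θ.res.X P).fam8R (θ.res.X P).lan8 (θ.res.X P).cub8 (θ.res.X P).toAxial8)
    (h06 : B9LeafX (Y9OfRecord N θ.toStage3Params Mstar ops))
    (h07 : B11Leaf (Z11OfRecord F N ζ))
    (h08 : PrintedUV3V N θ.L)
    (h09 : ∀ P : B12.RunParams, B12Sec2to5.Lemma4Printed (θ.res.X P).F12 (θ.res.X P).c12)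
    (h09T : ∀ P : B12.RunParams, (leavesP w P).smallCouplings → (leavesP w P).smallFieldInductive)
    (h10 : ∀ P : B12.RunParams, B9LeafX (Y9OfRecord N θ.toStage3Params Mstar ops) →
      (B10.Thm1PrintedCompact ((θ.view₁₃B10YZW F N Mstar ops ζ lamW).res.X P).runs10 ∧
          B10.Thm2Printed ((θ.view₁₃B10YZW F N Mstar ops ζ lamW).res.X P).runs10) →
        B11Leaf (Z11OfRecord F N ζ) → B12Sec2to5.Lemma4Printed (θ.res.X P).F12 (θ.res.X P).c12 →
          B13.Lemma1Printed (θ.res.X P).S13 (θ.res.X P).c13 ∧ B13.Lemma2Printed (θ.res.X P).S13 (θ.res.X P).c13 ∧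
            B13.Lemma3Printed (θ.res.X P).S13 (θ.res.X P).c13)
    (h11 : ∀ P : B12.RunParams, (leavesP w P).b7 → (leavesP w P).b8 → (leavesP w P).b9 → (leavesP w P).b10 → (leavesP w P).b11 →
      (leavesP w P).smallCouplings → (leavesP w P).smallFieldInductive → (leavesP w P).flowControl →
        ∀ k, k < P.K → SLaw₁₃ F N θ P k → TLaw₁₃ F N θ P k)
    (h12 : ∀ P : B12.RunParams, B15Leaf (WOfRecord₁₃ F N θ lamW P))
    (hR : ∀ (P : B12.RunParams) (k : ℕ), k < P.K → TLaw₁₃ F N θ P k → SLaw₁₃ F N θ P (k + 1))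
    (hUV : ∀ P : B12.RunParams, (genFlow (betaOfRecord₁₃ F N θ) P.g0).InInterval w.γ P.K → ∀ k, k ≤ P.K → SLaw₁₃ F N θ P k →
      ∀ U : GaugeField (F.P P.K) k (SU N),
        chiβOfRecord₁₃ F N θ P.K (gOfRecord₁₃ F N θ P) k U *
              Real.exp (-(1 / (gOfRecord₁₃ F N θ P k) ^ 2 * wilsonBGOfRecord F N θ.εbg P k U)
                - w.em (gOfRecord₁₃ F N θ P k) * (Fintype.card (Site (F.P P.K) k) : ℝ)) ≤ densOfRecord₁₃ F N θ P k U ∧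
        densOfRecord₁₃ F N θ P k U ≤ Real.exp (w.ep (gOfRecord₁₃ F N θ P k) * (Fintype.card (Site (F.P P.K) k) : ℝ))) :
    IsRecordOfRecord₁₃C F N (datumOfRecord₁₃ F N θ hP) w ∧ ∀ P : B12.RunParams, Nodes (leavesP w P) := by
  have hrec : IsRecordOfRecord₁₃C F N (datumOfRecord₁₃ F N θ hP) w :=
    N24_isRecordOfRecord₁₃C_of_up_view₁₃B10YZW θ hP hθ Mstar ops ζ lamW w hC hγ hL hup
  refine ⟨hrec, fun P => ?_⟩
  have hl := upOfRecord₅C_view₁₃B10YZW_leaves F N θ Mstar ops ζ lamW P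
  have h8 : (w.up P).b8 := by
    rw [hup P]; exact (B11LeafUnpinnedRecord.upOfRecord₅C_b8_b9_b11 (θ.view₁₃B10YZW F N Mstar ops ζ lamW) P).1.2 (h05 P)
  have h9 : (w.up P).b9 := by rw [hup P]; exact hl.2.1.2 h06
  have h10leaf : (w.up P).b10 := by rw [hup P]; exact hl.2.2.1.2 h08
  have h11leaf : (w.up P).b11 := by rw [hup P]; exact hl.2.2.2.2 h07
  have h15 : (w.up P).rBasicStep := by rw [hup P]; exact hl.1.2 (h12 P)
  have h12leaf : (leavesP w P).b12 := by
    show (w.up P).b12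
    rw [hup P]; exact h09 P
  exact ⟨b4_main_of_isRecordOfRecord₁₃C hrec P, b5_main_of_isRecordOfRecord₁₃C hrec P, N24_b6_main_of_isRecordOfRecord₁₃C hrec P,
    b7_main_of_isRecordOfRecord₁₃C hrec P, B8LeafKnit.b8_main_of_leaf w P h8, fun _ _ _ _ => h9, fun _ _ _ _ _ _ => h10leaf,
    fun _ _ _ _ _ => h11leaf, B12NodeKnitRecord8.b12_main_of_leaf_of_thm3Member h12leaf (h09T P),
    B13NodeKnitRecord5C.b13_main_at_stage5ParamsC F N (θ.view₁₃B10YZW F N Mstar ops ζ lamW) w P (hup P) (h10 P),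
    b14_main_at_construction_rhoOfRecord9_along F N (coreOfRecord₁₃ F N θ) w P θ.ν θ.τ9 (EOfRecord₁₃ F N θ) (wOfRecord₉ F N θ.toStage9Params) θ.ppSel
      (gOfRecord₁₃ F N θ) (fun p k _ => SLaw₁₃ F N θ p k) (fun p k _ => TLaw₁₃ F N θ p k) (hC.trans (datumOfRecord₁₃_C F N θ hP))
      (fun _ _ => Iff.rfl) (fun _ => sLaw₁₃_zero F N θ P) (h11 P) (fun hrop => (N24_rOperation_iff_of_up_view₁₃B10YZW θ Mstar ops ζ lamW (hup P)).1 hrop),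
    B15LeafKnit.b15_main_of_up (U := w.up P) rfl h15,
    b16_main_at_repTowerOfRecord_along F N (coreOfRecord₁₃ F N θ) w P θ.ν θ.τ9 (EOfRecord₁₃ F N θ) (wOfRecord₉ F N θ.toStage9Params) θ.ppSel
      (gOfRecord₁₃ F N θ) (fun k _ => SLaw₁₃ F N θ P k) (fun k _ => TLaw₁₃ F N θ P k) (hC.trans (datumOfRecord₁₃_C F N θ hP))
      (fun _ _ => Iff.rfl) (N24_rOperation_iff_of_up_view₁₃B10YZW θ Mstar ops ζ lamW (hup P)).2 (hR P) le_rfl (hUV P)⟩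

/-! ## §2. (B) and item K1‴'s θ-keyed consequent at the presentation's datum, from §1 and the β-box pair -/

/-- **N24 · (B2) AT THE STAGE-13 PRESENTATION'S DATUM FROM THE POINTED CHILDREN OVER THE FOUR-PIN VIEW AND THE β-BOX PAIR** (§1 into def-T's
`endStatementBPrinted_of_isRecordOfRecord₁₃C_of_nodes` with module 38's interval β-binder).  COMPOSITE: nothing is discharged.
[cite: Balaban1989LargeFieldII, Thm 1 p.355, (0.1) pp.355–356, p.391; Balaban1988Convergent, (3.16)–(3.22) pp.268–269; Balaban1987RG1, Thm 3 p.264, (0.17)–(0.20) pp.255–256 and (1.22) p.264; Balaban1985UV3, Thm 1 p.257 + Thm 2 p.272 (bookkeeping)] -/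
theorem N24_endStatementBPrinted₁₃_fourPin_pointed (θ : Stage13Params F N) (hP : θ.Provisos₁₃ F N) (hθ : θ.Admissible F N)
    (Mstar : ℕ) (ops : OpsY N θ.toStage3Params Mstar) (ζ : ResidZ F N) (lamW : ResidW F N) (w : WorldP)
    (hC : w.C = (datumOfRecord₁₃ F N θ hP).C) (hγ : 0 < w.γ ∧ w.γ ≤ θ.γ) (hL : w.L = (θ.L : ℝ))
    (hup : ∀ P, w.up P = upOfRecord₅C F N (θ.view₁₃B10YZW F N Mstar ops ζ lamW) P)
    (h05 : ∀ P : B12.RunParams,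
      B8LeafR (θ.res.X P).d8 (θ.res.X P).L8 (θ.res.X P).C₂ (θ.res.X P).B₁' (θ.res.X P).B₀' (θ.res.X P).B₁ (θ.res.X P).B₂ (θ.res.X P).c₁
        (θ.res.X P).inp8 (θ.res.X P).B₀β (θ.res.X P).loc8 (θ.res.X P).fam8R (θ.res.X P).lan8 (θ.res.X P).cub8 (θ.res.X P).toAxial8)
    (h06 : B9LeafX (Y9OfRecord N θ.toStage3Params Mstar ops))
    (h07 : B11Leaf (Z11OfRecord F N ζ))
    (h08 : PrintedUV3V N θ.L)
    (h09 : ∀ P : B12.RunParams, B12Sec2to5.Lemma4Printed (θ.res.X P).F12 (θ.res.X P).c12)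
    (h09T : ∀ P : B12.RunParams, (leavesP w P).smallCouplings → (leavesP w P).smallFieldInductive)
    (h10 : ∀ P : B12.RunParams, B9LeafX (Y9OfRecord N θ.toStage3Params Mstar ops) →
      (B10.Thm1PrintedCompact ((θ.view₁₃B10YZW F N Mstar ops ζ lamW).res.X P).runs10 ∧
          B10.Thm2Printed ((θ.view₁₃B10YZW F N Mstar ops ζ lamW).res.X P).runs10) →
        B11Leaf (Z11OfRecord F N ζ) → B12Sec2to5.Lemma4Printed (θ.res.X P).F12 (θ.res.X P).c12 →
          B13.Lemma1Printed (θ.res.X P).S13 (θ.res.X P).c13 ∧ B13.Lemma2Printed (θ.res.X P).S13 (θ.res.X P).c13 ∧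
            B13.Lemma3Printed (θ.res.X P).S13 (θ.res.X P).c13)
    (h11 : ∀ P : B12.RunParams, (leavesP w P).b7 → (leavesP w P).b8 → (leavesP w P).b9 → (leavesP w P).b10 → (leavesP w P).b11 →
      (leavesP w P).smallCouplings → (leavesP w P).smallFieldInductive → (leavesP w P).flowControl →
        ∀ k, k < P.K → SLaw₁₃ F N θ P k → TLaw₁₃ F N θ P k)
    (h12 : ∀ P : B12.RunParams, B15Leaf (WOfRecord₁₃ F N θ lamW P))
    (hR : ∀ (P : B12.RunParams) (k : ℕ), k < P.K → TLaw₁₃ F N θ P k → SLaw₁₃ F N θ P (k + 1))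
    (hUV : ∀ P : B12.RunParams, (genFlow (betaOfRecord₁₃ F N θ) P.g0).InInterval w.γ P.K → ∀ k, k ≤ P.K → SLaw₁₃ F N θ P k →
      ∀ U : GaugeField (F.P P.K) k (SU N),
        chiβOfRecord₁₃ F N θ P.K (gOfRecord₁₃ F N θ P) k U *
              Real.exp (-(1 / (gOfRecord₁₃ F N θ P k) ^ 2 * wilsonBGOfRecord F N θ.εbg P k U)
                - w.em (gOfRecord₁₃ F N θ P k) * (Fintype.card (Site (F.P P.K) k) : ℝ)) ≤ densOfRecord₁₃ F N θ P k U ∧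
        densOfRecord₁₃ F N θ P k U ≤ Real.exp (w.ep (gOfRecord₁₃ F N θ P k) * (Fintype.card (Site (F.P P.K) k) : ℝ)))
    (hlo : BetaLowerH w.b w.γ (datumOfRecord₁₃ F N θ hP).βfun) (hhi : BetaUpperH w.βup w.γ (datumOfRecord₁₃ F N θ hP).βfun) :
    B16.EndStatementBPrinted (datumOfRecord₁₃ F N θ hP).C := by
  obtain ⟨hrec, hn⟩ := N24_nodes₁₃B10YZW_pointed θ hP hθ Mstar ops ζ lamW w hC hγ hL hup h05 h06 h07 h08 h09 h09T h10 h11 h12 hR hUV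
  exact endStatementBPrinted_of_isRecordOfRecord₁₃C_of_nodes hrec le_rfl hn (N24_betaBoundsInInterval_of_isRecordOfRecord₁₃C_of_boxH hrec hlo hhi)

/-- **THE CONSEQUENT OF ITEM K1‴ `StabilityBAtRecordR13e` (rev 16, stmt-QuantumFields-19910) IN ITS θ-KEYED SHAPE, WITNESSED BY `(θ, hP)`, FROM THE POINTED CHILDREN OVER THE FOUR-PIN
VIEW** (guard `hU` DISPLAYED = K0‴'s product; window from `hhi` by module 26).  COMPOSITE: nothing is discharged.
[cite: Balaban1989LargeFieldII, Thm 1 p.355, (0.1) pp.355–356, p.391; Balaban1988Convergent, (3.16)–(3.22) pp.268–269; Balaban1987RG1, Thm 3 p.264, (0.17)–(0.20) pp.255–256 and (1.22) p.264, (2.9) p.266; Balaban1985UV3, Thm 1 p.257 (bookkeeping + elementary window)] -/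
theorem N24_stabilityBR13e_thetaShape16_fourPin_pointed (θ : Stage13Params F N) (hP : θ.Provisos₁₃ F N) (hθ : θ.Admissible F N)
    (hU : θ.ZtUnity F N ∧ θ.SlotsNondegenerate₁₃ F N) (Mstar : ℕ) (ops : OpsY N θ.toStage3Params Mstar) (ζ : ResidZ F N) (lamW : ResidW F N)
    (w : WorldP)
    (hC : w.C = (datumOfRecord₁₃ F N θ hP).C) (hγ : 0 < w.γ ∧ w.γ ≤ θ.γ) (hL : w.L = (θ.L : ℝ))
    (hup : ∀ P, w.up P = upOfRecord₅C F N (θ.view₁₃B10YZW F N Mstar ops ζ lamW) P)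
    (h05 : ∀ P : B12.RunParams,
      B8LeafR (θ.res.X P).d8 (θ.res.X P).L8 (θ.res.X P).C₂ (θ.res.X P).B₁' (θ.res.X P).B₀' (θ.res.X P).B₁ (θ.res.X P).B₂ (θ.res.X P).c₁
        (θ.res.X P).inp8 (θ.res.X P).B₀β (θ.res.X P).loc8 (θ.res.X P).fam8R (θ.res.X P).lan8 (θ.res.X P).cub8 (θ.res.X P).toAxial8)
    (h06 : B9LeafX (Y9OfRecord N θ.toStage3Params Mstar ops))
    (h07 : B11Leaf (Z11OfRecord F N ζ))
    (h08 : PrintedUV3V N θ.L)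
    (h09 : ∀ P : B12.RunParams, B12Sec2to5.Lemma4Printed (θ.res.X P).F12 (θ.res.X P).c12)
    (h09T : ∀ P : B12.RunParams, (leavesP w P).smallCouplings → (leavesP w P).smallFieldInductive)
    (h10 : ∀ P : B12.RunParams, B9LeafX (Y9OfRecord N θ.toStage3Params Mstar ops) →
      (B10.Thm1PrintedCompact ((θ.view₁₃B10YZW F N Mstar ops ζ lamW).res.X P).runs10 ∧
          B10.Thm2Printed ((θ.view₁₃B10YZW F N Mstar ops ζ lamW).res.X P).runs10) →
        B11Leaf (Z11OfRecord F N ζ) → B12Sec2to5.Lemma4Printed (θ.res.X P).F12 (θ.res.X P).c12 →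
          B13.Lemma1Printed (θ.res.X P).S13 (θ.res.X P).c13 ∧ B13.Lemma2Printed (θ.res.X P).S13 (θ.res.X P).c13 ∧
            B13.Lemma3Printed (θ.res.X P).S13 (θ.res.X P).c13)
    (h11 : ∀ P : B12.RunParams, (leavesP w P).b7 → (leavesP w P).b8 → (leavesP w P).b9 → (leavesP w P).b10 → (leavesP w P).b11 →
      (leavesP w P).smallCouplings → (leavesP w P).smallFieldInductive → (leavesP w P).flowControl →
        ∀ k, k < P.K → SLaw₁₃ F N θ P k → TLaw₁₃ F N θ P k)
    (h12 : ∀ P : B12.RunParams, B15Leaf (WOfRecord₁₃ F N θ lamW P))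
    (hR : ∀ (P : B12.RunParams) (k : ℕ), k < P.K → TLaw₁₃ F N θ P k → SLaw₁₃ F N θ P (k + 1))
    (hUV : ∀ P : B12.RunParams, (genFlow (betaOfRecord₁₃ F N θ) P.g0).InInterval w.γ P.K → ∀ k, k ≤ P.K → SLaw₁₃ F N θ P k →
      ∀ U : GaugeField (F.P P.K) k (SU N),
        chiβOfRecord₁₃ F N θ P.K (gOfRecord₁₃ F N θ P) k U *
              Real.exp (-(1 / (gOfRecord₁₃ F N θ P k) ^ 2 * wilsonBGOfRecord F N θ.εbg P k U)
                - w.em (gOfRecord₁₃ F N θ P k) * (Fintype.card (Site (F.P P.K) k) : ℝ)) ≤ densOfRecord₁₃ F N θ P k U ∧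
        densOfRecord₁₃ F N θ P k U ≤ Real.exp (w.ep (gOfRecord₁₃ F N θ P k) * (Fintype.card (Site (F.P P.K) k) : ℝ)))
    (hlo : BetaLowerH w.b w.γ (datumOfRecord₁₃ F N θ hP).βfun) (hhi : BetaUpperH w.βup w.γ (datumOfRecord₁₃ F N θ hP).βfun) :
    ∃ (θ' : Stage13Params F N) (h' : θ'.Provisos₁₃ F N), (θ'.ZtUnity F N ∧ θ'.SlotsNondegenerate₁₃ F N) ∧ θ'.Admissible F N ∧
      B16.EndStatementBPrinted (datumOfRecord₁₃ F N θ' h').C ∧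
      ∃ γ₁ : ℝ, 0 < γ₁ ∧ ∀ γ : ℝ, 0 < γ → γ ≤ γ₁ → ∃ P : B12.RunParams, 1 ≤ P.K ∧ ((datumOfRecord₁₃ F N θ' h').C P).flow.InInterval γ P.K :=
  ⟨θ, hP, hU, hθ, N24_endStatementBPrinted₁₃_fourPin_pointed θ hP hθ Mstar ops ζ lamW w hC hγ hL hup h05 h06 h07 h08 h09 h09T h10 h11 h12 hR hUV hlo hhi,
    N24_window_of_betaUpperH _ hγ.1 hhi⟩

/-! ## §3. The rung bodies of K1‴'s registered skeleton (`NodesAtSomeRecord13`, `BetaWindowAtSomeRecord13`) at general `N`, over the four-pin view -/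

/-- **THE BODY OF `NodesAtSomeRecord13` OVER THE FOUR-PIN STAGE-13 VIEW, EVERY CHILD BY NAME OR DISPLAYED** (general `N`; guard `hU` DISPLAYED — K0‴'s product): witnesses
`(θ, hP, w)` themselves (§1).  At `N := 2` the ∃-body of plan g66's `NodesAtSomeRecord13 F`. [cite: Balaban1989LargeFieldII, Thm 1 p.355, (0.1) pp.355–356, p.391; Balaban1985UV3, Thm 1 p.257 + Thm 2 p.272; Balaban1987RG1, Thm 3 p.264; Balaban1985Variational, Thm 1 p.279; Balaban1988Convergent, Thm 1 p.262, Cor. 3 (2.50) p.264 (bookkeeping)] -/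
theorem N24_nodesAtSomeRecord₁₃_of_fourPin_pointed (θ : Stage13Params F N) (hP : θ.Provisos₁₃ F N) (hθ : θ.Admissible F N)
    (hU : θ.ZtUnity F N ∧ θ.SlotsNondegenerate₁₃ F N) (Mstar : ℕ) (ops : OpsY N θ.toStage3Params Mstar) (ζ : ResidZ F N) (lamW : ResidW F N)
    (w : WorldP)
    (hC : w.C = (datumOfRecord₁₃ F N θ hP).C) (hγ : 0 < w.γ ∧ w.γ ≤ θ.γ) (hL : w.L = (θ.L : ℝ))
    (hup : ∀ P, w.up P = upOfRecord₅C F N (θ.view₁₃B10YZW F N Mstar ops ζ lamW) P)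
    (h05 : ∀ P : B12.RunParams,
      B8LeafR (θ.res.X P).d8 (θ.res.X P).L8 (θ.res.X P).C₂ (θ.res.X P).B₁' (θ.res.X P).B₀' (θ.res.X P).B₁ (θ.res.X P).B₂ (θ.res.X P).c₁
        (θ.res.X P).inp8 (θ.res.X P).B₀β (θ.res.X P).loc8 (θ.res.X P).fam8R (θ.res.X P).lan8 (θ.res.X P).cub8 (θ.res.X P).toAxial8)
    (h06 : B9LeafX (Y9OfRecord N θ.toStage3Params Mstar ops))
    (h07 : B11Leaf (Z11OfRecord F N ζ))
    (h08 : PrintedUV3V N θ.L)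
    (h09 : ∀ P : B12.RunParams, B12Sec2to5.Lemma4Printed (θ.res.X P).F12 (θ.res.X P).c12)
    (h09T : ∀ P : B12.RunParams, (leavesP w P).smallCouplings → (leavesP w P).smallFieldInductive)
    (h10 : ∀ P : B12.RunParams, B9LeafX (Y9OfRecord N θ.toStage3Params Mstar ops) →
      (B10.Thm1PrintedCompact ((θ.view₁₃B10YZW F N Mstar ops ζ lamW).res.X P).runs10 ∧
          B10.Thm2Printed ((θ.view₁₃B10YZW F N Mstar ops ζ lamW).res.X P).runs10) →
        B11Leaf (Z11OfRecord F N ζ) → B12Sec2to5.Lemma4Printed (θ.res.X P).F12 (θ.res.X P).c12 →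
          B13.Lemma1Printed (θ.res.X P).S13 (θ.res.X P).c13 ∧ B13.Lemma2Printed (θ.res.X P).S13 (θ.res.X P).c13 ∧
            B13.Lemma3Printed (θ.res.X P).S13 (θ.res.X P).c13)
    (h11 : ∀ P : B12.RunParams, (leavesP w P).b7 → (leavesP w P).b8 → (leavesP w P).b9 → (leavesP w P).b10 → (leavesP w P).b11 →
      (leavesP w P).smallCouplings → (leavesP w P).smallFieldInductive → (leavesP w P).flowControl →
        ∀ k, k < P.K → SLaw₁₃ F N θ P k → TLaw₁₃ F N θ P k)
    (h12 : ∀ P : B12.RunParams, B15Leaf (WOfRecord₁₃ F N θ lamW P))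
    (hR : ∀ (P : B12.RunParams) (k : ℕ), k < P.K → TLaw₁₃ F N θ P k → SLaw₁₃ F N θ P (k + 1))
    (hUV : ∀ P : B12.RunParams, (genFlow (betaOfRecord₁₃ F N θ) P.g0).InInterval w.γ P.K → ∀ k, k ≤ P.K → SLaw₁₃ F N θ P k →
      ∀ U : GaugeField (F.P P.K) k (SU N),
        chiβOfRecord₁₃ F N θ P.K (gOfRecord₁₃ F N θ P) k U *
              Real.exp (-(1 / (gOfRecord₁₃ F N θ P k) ^ 2 * wilsonBGOfRecord F N θ.εbg P k U)
                - w.em (gOfRecord₁₃ F N θ P k) * (Fintype.card (Site (F.P P.K) k) : ℝ)) ≤ densOfRecord₁₃ F N θ P k U ∧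
        densOfRecord₁₃ F N θ P k U ≤ Real.exp (w.ep (gOfRecord₁₃ F N θ P k) * (Fintype.card (Site (F.P P.K) k) : ℝ))) :
    ∃ (θ' : Stage13Params F N) (h' : θ'.Provisos₁₃ F N) (w' : WorldP), (θ'.ZtUnity F N ∧ θ'.SlotsNondegenerate₁₃ F N) ∧ θ'.Admissible F N ∧
      IsRecordOfRecord₁₃C F N (datumOfRecord₁₃ F N θ' h') w' ∧ ∀ P : B12.RunParams, Nodes (leavesP w' P) := by
  obtain ⟨hrec, hn⟩ := N24_nodes₁₃B10YZW_pointed θ hP hθ Mstar ops ζ lamW w hC hγ hL hup h05 h06 h07 h08 h09 h09T h10 h11 h12 hR hUV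
  exact ⟨θ, hP, w, hU, hθ, hrec, hn⟩

/-- **THE BODY OF `BetaWindowAtSomeRecord13` OVER THE FOUR-PIN STAGE-13 VIEW FROM THE POINTED CHILDREN AND THE β-BOX PAIR** (§1 + module 38's
`N24_betaBoundsInInterval_of_isRecordOfRecord₁₃C_of_boxH` + module 26's window; guard `hU` DISPLAYED).  At `N := 2` the ∃-body of plan g66's `BetaWindowAtSomeRecord13 F`.
[cite: Balaban1989LargeFieldII, Thm 1 p.355, (0.1) pp.355–356, p.391; Balaban1987RG1, Thm 3 p.264, (0.17)–(0.20) pp.255–256 and (1.22) p.264, (2.9) p.266; Balaban1985UV3, Thm 1 p.257 (bookkeeping + elementary window)] -/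
theorem N24_betaWindowAtSomeRecord₁₃_of_fourPin_pointed_of_boxH (θ : Stage13Params F N) (hP : θ.Provisos₁₃ F N) (hθ : θ.Admissible F N)
    (hU : θ.ZtUnity F N ∧ θ.SlotsNondegenerate₁₃ F N) (Mstar : ℕ) (ops : OpsY N θ.toStage3Params Mstar) (ζ : ResidZ F N) (lamW : ResidW F N)
    (w : WorldP)
    (hC : w.C = (datumOfRecord₁₃ F N θ hP).C) (hγ : 0 < w.γ ∧ w.γ ≤ θ.γ) (hL : w.L = (θ.L : ℝ))
    (hup : ∀ P, w.up P = upOfRecord₅C F N (θ.view₁₃B10YZW F N Mstar ops ζ lamW) P)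
    (h05 : ∀ P : B12.RunParams,
      B8LeafR (θ.res.X P).d8 (θ.res.X P).L8 (θ.res.X P).C₂ (θ.res.X P).B₁' (θ.res.X P).B₀' (θ.res.X P).B₁ (θ.res.X P).B₂ (θ.res.X P).c₁
        (θ.res.X P).inp8 (θ.res.X P).B₀β (θ.res.X P).loc8 (θ.res.X P).fam8R (θ.res.X P).lan8 (θ.res.X P).cub8 (θ.res.X P).toAxial8)
    (h06 : B9LeafX (Y9OfRecord N θ.toStage3Params Mstar ops))
    (h07 : B11Leaf (Z11OfRecord F N ζ))
    (h08 : PrintedUV3V N θ.L)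
    (h09 : ∀ P : B12.RunParams, B12Sec2to5.Lemma4Printed (θ.res.X P).F12 (θ.res.X P).c12)
    (h09T : ∀ P : B12.RunParams, (leavesP w P).smallCouplings → (leavesP w P).smallFieldInductive)
    (h10 : ∀ P : B12.RunParams, B9LeafX (Y9OfRecord N θ.toStage3Params Mstar ops) →
      (B10.Thm1PrintedCompact ((θ.view₁₃B10YZW F N Mstar ops ζ lamW).res.X P).runs10 ∧
          B10.Thm2Printed ((θ.view₁₃B10YZW F N Mstar ops ζ lamW).res.X P).runs10) →
        B11Leaf (Z11OfRecord F N ζ) → B12Sec2to5.Lemma4Printed (θ.res.X P).F12 (θ.res.X P).c12 →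
          B13.Lemma1Printed (θ.res.X P).S13 (θ.res.X P).c13 ∧ B13.Lemma2Printed (θ.res.X P).S13 (θ.res.X P).c13 ∧
            B13.Lemma3Printed (θ.res.X P).S13 (θ.res.X P).c13)
    (h11 : ∀ P : B12.RunParams, (leavesP w P).b7 → (leavesP w P).b8 → (leavesP w P).b9 → (leavesP w P).b10 → (leavesP w P).b11 →
      (leavesP w P).smallCouplings → (leavesP w P).smallFieldInductive → (leavesP w P).flowControl →
        ∀ k, k < P.K → SLaw₁₃ F N θ P k → TLaw₁₃ F N θ P k)
    (h12 : ∀ P : B12.RunParams, B15Leaf (WOfRecord₁₃ F N θ lamW P))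
    (hR : ∀ (P : B12.RunParams) (k : ℕ), k < P.K → TLaw₁₃ F N θ P k → SLaw₁₃ F N θ P (k + 1))
    (hUV : ∀ P : B12.RunParams, (genFlow (betaOfRecord₁₃ F N θ) P.g0).InInterval w.γ P.K → ∀ k, k ≤ P.K → SLaw₁₃ F N θ P k →
      ∀ U : GaugeField (F.P P.K) k (SU N),
        chiβOfRecord₁₃ F N θ P.K (gOfRecord₁₃ F N θ P) k U *
              Real.exp (-(1 / (gOfRecord₁₃ F N θ P k) ^ 2 * wilsonBGOfRecord F N θ.εbg P k U)
                - w.em (gOfRecord₁₃ F N θ P k) * (Fintype.card (Site (F.P P.K) k) : ℝ)) ≤ densOfRecord₁₃ F N θ P k U ∧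
        densOfRecord₁₃ F N θ P k U ≤ Real.exp (w.ep (gOfRecord₁₃ F N θ P k) * (Fintype.card (Site (F.P P.K) k) : ℝ)))
    (hlo : BetaLowerH w.b w.γ (datumOfRecord₁₃ F N θ hP).βfun) (hhi : BetaUpperH w.βup w.γ (datumOfRecord₁₃ F N θ hP).βfun) :
    ∃ (θ' : Stage13Params F N) (h' : θ'.Provisos₁₃ F N) (w' : WorldP), (θ'.ZtUnity F N ∧ θ'.SlotsNondegenerate₁₃ F N) ∧ θ'.Admissible F N ∧
      IsRecordOfRecord₁₃C F N (datumOfRecord₁₃ F N θ' h') w' ∧ (∀ P : B12.RunParams, Nodes (leavesP w' P)) ∧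
      BetaBoundsInInterval w'.C.toB12 w'.γ w'.b w'.βup ∧
      ∃ γ₁ : ℝ, 0 < γ₁ ∧ ∀ γ : ℝ, 0 < γ → γ ≤ γ₁ → ∃ P : B12.RunParams, 1 ≤ P.K ∧ ((datumOfRecord₁₃ F N θ' h').C P).flow.InInterval γ P.K := by
  obtain ⟨hrec, hn⟩ := N24_nodes₁₃B10YZW_pointed θ hP hθ Mstar ops ζ lamW w hC hγ hL hup h05 h06 h07 h08 h09 h09T h10 h11 h12 hR hUV
  exact ⟨θ, hP, w, hU, hθ, hrec, hn, N24_betaBoundsInInterval_of_isRecordOfRecord₁₃C_of_boxH hrec hlo hhi, N24_window_of_betaUpperH _ hγ.1 hhi⟩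

end Literature.MathematicalPhysics.QuantumFieldTheory.Balaban1983to89.Node00

end
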